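import Literature.Analysis.FluidPDE.ElgindiPolarEnergy
import Literature.Analysis.FluidPDE.ElgindiPolarIBPTwo
import Literature.Analysis.FluidPDE.ElgindiStripCalculusTwo
import HarnessLib

/-!
# The second energy identity of the polar model operator ([Elgindi2021] §7.1, Proposition 7.1
Step 2, the multiplier `−∂_θθΨ`)

Topic `Literature/Analysis/FluidPDE`. Proof file (everything proved, no definitions, no named
facts) on the proof path of the named fact
`Literature.Analysis.FluidPDE.Elgindi.ElgindiGhoulMasmoudi2021_stabilityCore`
(`ElgindiStabilityDecomposition.lean`). T. M. Elgindi, Ann. of Math. 194 (2021) =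
arXiv:1904.04795, §7.1 proof of Proposition 7.1, Step 2 (pp. 19–20):

> "Now we come back to equation (PolarBSL) and multiply by `−∂_θθΨ` and integrate. Integrating by
> parts in `R` and `θ` we get: `α²|R∂_{Rθ}Ψ|² − α²|∂_θΨ|² + (α(5+α)/2)|∂_θΨ|² + |∂_θθΨ|² − 6|∂_θΨ|²
> − ∫∂_θ(tan(θ)Ψ)∂_θθΨ = ∫F∂_θθΨ.` … `−∫∂_θ(tanθΨ)∂_θθΨ = (3/2)∫(∂_θΨ̃)² + G`".

Exactly this, in `L²(dRdθ)` of the open strip, for the a-priori class `Ψ = cosθ·χ`, `χ ∈ C³(ℝ²)`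
compactly supported with `χ(R,0) = 0` (`Ψ̃ = χ`), with the `tan`-term in closed form
(`G = ½‖χ‖²`, `ElgindiPolarIBPTwo.lean`):
`∫∫_strip L(Ψ)(−Ψ_θθ) = α²‖RΨ_{Rθ}‖² + (α(5+α)/2 − α² − 6)‖Ψ_θ‖² + ‖Ψ_θθ‖² + (3/2)‖χ_θ‖² + ½‖χ‖²`
(`integral_strip_ellipticOp_mul_neg_dθdθ`).
-/

noncomputable section

open MeasureTheory Set Real Filter Function intervalIntegral
open _root_.Topology

namespace Literature.Analysis.FluidPDE

namespace Elgindi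

/-! ### More slice calculus for the profile class -/

/-- The second angular slice derivative of the profile. [folklore] -/
theorem dθ_dθ_cosProfile {χ : ℝ → ℝ → ℝ} (hχ : ContDiff ℝ 2 (uncurry χ)) (R θ : ℝ) :
    dθ (dθ fun R θ => Real.cos θ * χ R θ) R θ =
      -Real.cos θ * χ R θ - 2 * Real.sin θ * dθ χ R θ + Real.cos θ * dθ (dθ χ) R θ := by
  have hχ1 : ContDiff ℝ 1 (uncurry χ) := hχ.of_le (by norm_num)
  have hdθχ : ContDiff ℝ 1 (uncurry (dθ χ)) := contDiff_dθ_of_contDiff (n := 1) hχ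
  have e : dθ (fun R θ => Real.cos θ * χ R θ) = fun R θ => -Real.sin θ * χ R θ + Real.cos θ * dθ χ R θ := by
    funext R θ; exact dθ_cosProfile hχ1 R θ
  rw [e]
  have e1 : (fun θ' => χ R θ') = uncurry χ ∘ fun θ' => (R, θ') := rfl
  have e2 : (fun θ' => dθ χ R θ') = uncurry (dθ χ) ∘ fun θ' => (R, θ') := rfl
  have hd1 : DifferentiableAt ℝ (fun θ' => χ R θ') θ := by
    rw [e1]; exact ((hχ.differentiable (by simp)) (R, θ)).comp θ ((differentiableAt_const _).prodMk differentiableAt_id)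
  have hd2 : DifferentiableAt ℝ (fun θ' => dθ χ R θ') θ := by
    rw [e2]; exact ((hdθχ.differentiable (by simp)) (R, θ)).comp θ ((differentiableAt_const _).prodMk differentiableAt_id)
  show deriv (fun θ' => -Real.sin θ' * χ R θ' + Real.cos θ' * dθ χ R θ') θ = _
  have hns : HasDerivAt (fun θ' => -Real.sin θ') (-Real.cos θ) θ := (Real.hasDerivAt_sin θ).neg
  have h : HasDerivAt (fun θ' => -Real.sin θ' * χ R θ' + Real.cos θ' * dθ χ R θ')
      (-Real.cos θ * χ R θ + -Real.sin θ * deriv (fun θ' => χ R θ') θ +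
        (-Real.sin θ * dθ χ R θ + Real.cos θ * deriv (fun θ' => dθ χ R θ') θ)) θ :=
    (hns.mul hd1.hasDerivAt).add ((Real.hasDerivAt_cos θ).mul hd2.hasDerivAt)
  rw [h.deriv]
  show -Real.cos θ * χ R θ + -Real.sin θ * dθ χ R θ + (-Real.sin θ * dθ χ R θ + Real.cos θ * dθ (dθ χ) R θ) = _
  ring

/-- A slice in `R` of a function vanishing identically on a horizontal line has vanishing radial
derivatives there. [folklore] -/
theorem dz_eq_zero_of_forall {Ψ : ℝ → ℝ → ℝ} {θ₀ : ℝ} (h : ∀ R, Ψ R θ₀ = 0) (R : ℝ) : dz Ψ R θ₀ = 0 := by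
  show deriv (fun R' => Ψ R' θ₀) R = 0
  have : (fun R' => Ψ R' θ₀) = fun _ => 0 := funext h
  rw [this, deriv_const]

/-! ### The second energy identity -/

/-- **The second energy identity** (multiplier `−∂_θθΨ`): for `Ψ = cosθ·χ`, `χ ∈ C³(ℝ²)` compactly
supported with `χ(R,0) = 0`, and any real `α`,
`∫∫_strip L(Ψ)·(−Ψ_θθ) = α²‖RΨ_{Rθ}‖² + (α(5+α)/2 − α² − 6)‖Ψ_θ‖² + ‖Ψ_θθ‖² + (3/2)‖χ_θ‖² + ½‖χ‖²`
(`L²(dRdθ)` norms; `Ψ_{Rθ} = dz (dθ Ψ)`). [cite: Elgindi2021, §7.1 proof of Proposition 7.1, Step 2 (pp. 19–20 of arXiv:1904.04795)] -/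
theorem integral_strip_ellipticOp_mul_neg_dθdθ (α : ℝ) {χ : ℝ → ℝ → ℝ} (hχ : ContDiff ℝ 3 (uncurry χ))
    (hs : HasCompactSupport (uncurry χ)) (hχ0 : ∀ R, χ R 0 = 0) {Ψ : ℝ → ℝ → ℝ}
    (hΨ : Ψ = fun R θ => Real.cos θ * χ R θ) :
    ∫ p in strip, ellipticOp α Ψ p.1 p.2 * (-dθ (dθ Ψ) p.1 p.2) =
      α ^ 2 * (∫ p in strip, (p.1 * dz (dθ Ψ) p.1 p.2) ^ 2) + (α * (5 + α) / 2 - α ^ 2 - 6) * (∫ p in strip, dθ Ψ p.1 p.2 ^ 2) +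
        (∫ p in strip, dθ (dθ Ψ) p.1 p.2 ^ 2) + (3 / 2) * (∫ p in strip, dθ χ p.1 p.2 ^ 2) +
        (1 / 2) * ∫ p in strip, χ p.1 p.2 ^ 2 := by
  -- regularity
  have hχ2 : ContDiff ℝ 2 (uncurry χ) := hχ.of_le (by norm_num)
  have hχ1 : ContDiff ℝ 1 (uncurry χ) := hχ.of_le (by norm_num)
  have hΨ3 : ContDiff ℝ 3 (uncurry Ψ) := by rw [hΨ]; exact contDiff_cosProfile hχ
  have hΨ2 : ContDiff ℝ 2 (uncurry Ψ) := hΨ3.of_le (by norm_num)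
  have hΨ1 : ContDiff ℝ 1 (uncurry Ψ) := hΨ3.of_le (by norm_num)
  have hΨs : HasCompactSupport (uncurry Ψ) := by rw [hΨ]; exact hasCompactSupport_cosProfile hs
  have hdzΨ : ContDiff ℝ 2 (uncurry (dz Ψ)) := contDiff_dz_of_contDiff (n := 2) hΨ3
  have hdz2Ψ : ContDiff ℝ 1 (uncurry (dz (dz Ψ))) := contDiff_dz_of_contDiff (n := 1) hdzΨ
  have hdθΨ : ContDiff ℝ 2 (uncurry (dθ Ψ)) := contDiff_dθ_of_contDiff (n := 2) hΨ3
  have hdθ2Ψ : ContDiff ℝ 1 (uncurry (dθ (dθ Ψ))) := contDiff_dθ_of_contDiff (n := 1) hdθΨ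
  have hdzdθΨ : ContDiff ℝ 1 (uncurry (dz (dθ Ψ))) := contDiff_dz_of_contDiff (n := 1) hdθΨ
  have hdθχ : ContDiff ℝ 2 (uncurry (dθ χ)) := contDiff_dθ_of_contDiff (n := 2) hχ
  have hdθ2χ : ContDiff ℝ 1 (uncurry (dθ (dθ χ))) := contDiff_dθ_of_contDiff (n := 1) hdθχ
  have hdθΨs : HasCompactSupport (uncurry (dθ Ψ)) := hasCompactSupport_dθ_of hΨs
  have hdθ2Ψs : HasCompactSupport (uncurry (dθ (dθ Ψ))) := hasCompactSupport_dθ_of hdθΨs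
  have hdzdθΨs : HasCompactSupport (uncurry (dz (dθ Ψ))) := hasCompactSupport_dz hdθΨs
  have hdθχs : HasCompactSupport (uncurry (dθ χ)) := hasCompactSupport_dθ_of hs
  obtain ⟨b, hb⟩ := exists_forall_le_eq_zero hs
  set B : ℝ := max b 0 with hB
  have hB0 : 0 ≤ B := le_max_right _ _
  have hbχ : ∀ R, B ≤ R → ∀ θ, χ R θ = 0 := fun R hR θ => hb R ((le_max_left _ _).trans hR) θ
  have hbΨ : ∀ R, B ≤ R → ∀ θ, Ψ R θ = 0 := fun R hR θ => by rw [hΨ]; simp [hbχ R hR θ]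
  have hbdθΨ : ∀ R, B < R → ∀ θ, dθ Ψ R θ = 0 := by
    intro R hR θ
    show deriv (fun θ' => Ψ R θ') θ = 0
    have : (fun θ' => Ψ R θ') = fun _ => 0 := funext fun θ' => hbΨ R hR.le θ'
    rw [this, deriv_const]
  have hD0 : ∀ R, Ψ R 0 = 0 := fun R => by rw [hΨ]; simp [hχ0 R]
  have hD1 : ∀ R, Ψ R (π / 2) = 0 := fun R => by rw [hΨ]; simp
  -- boundary values of the radial derivatives on the two horizontal lines
  have hdz0 : ∀ R, dz Ψ R 0 = 0 := dz_eq_zero_of_forall hD0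
  have hdz1 : ∀ R, dz Ψ R (π / 2) = 0 := dz_eq_zero_of_forall hD1
  have hdzz0 : ∀ R, dz (dz Ψ) R 0 = 0 := dz_eq_zero_of_forall hdz0
  have hdzz1 : ∀ R, dz (dz Ψ) R (π / 2) = 0 := dz_eq_zero_of_forall hdz1
  -- continuity of the plane functions
  have cΨ : Continuous fun p : ℝ × ℝ => Ψ p.1 p.2 := hΨ3.continuous
  have cχ : Continuous fun p : ℝ × ℝ => χ p.1 p.2 := hχ.continuous
  have cdz : Continuous fun p : ℝ × ℝ => dz Ψ p.1 p.2 := hdzΨ.continuous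
  have cdz2 : Continuous fun p : ℝ × ℝ => dz (dz Ψ) p.1 p.2 := hdz2Ψ.continuous
  have cdθ : Continuous fun p : ℝ × ℝ => dθ Ψ p.1 p.2 := hdθΨ.continuous
  have cdθ2 : Continuous fun p : ℝ × ℝ => dθ (dθ Ψ) p.1 p.2 := hdθ2Ψ.continuous
  have cdzdθ : Continuous fun p : ℝ × ℝ => dz (dθ Ψ) p.1 p.2 := hdzdθΨ.continuous
  have cdz2dθ : Continuous fun p : ℝ × ℝ => dz (dz (dθ Ψ)) p.1 p.2 := continuous_dz hdzdθΨ
  have cdθdz2 : Continuous fun p : ℝ × ℝ => dθ (dz (dz Ψ)) p.1 p.2 := (contDiff_dθ_of_contDiff (n := 0) hdz2Ψ).continuous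
  have cdθdz : Continuous fun p : ℝ × ℝ => dθ (dz Ψ) p.1 p.2 := (contDiff_dθ_of_contDiff (n := 1) hdzΨ).continuous
  have cdθχ : Continuous fun p : ℝ × ℝ => dθ χ p.1 p.2 := hdθχ.continuous
  have cdθ2χ : Continuous fun p : ℝ × ℝ => dθ (dθ χ) p.1 p.2 := hdθ2χ.continuous
  -- the integrands
  set A : ℝ × ℝ → ℝ := fun p => p.1 ^ 2 * dz (dz Ψ) p.1 p.2 * dθ (dθ Ψ) p.1 p.2 with hA
  set A' : ℝ × ℝ → ℝ := fun p => p.1 ^ 2 * dθ (dz (dz Ψ)) p.1 p.2 * dθ Ψ p.1 p.2 with hA'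
  set A'' : ℝ × ℝ → ℝ := fun p => p.1 ^ 2 * dz (dz (dθ Ψ)) p.1 p.2 * dθ Ψ p.1 p.2 with hA''
  set Bf : ℝ × ℝ → ℝ := fun p => p.1 * dz Ψ p.1 p.2 * dθ (dθ Ψ) p.1 p.2 with hBf
  set B' : ℝ × ℝ → ℝ := fun p => p.1 * dθ (dz Ψ) p.1 p.2 * dθ Ψ p.1 p.2 with hB'
  set B'' : ℝ × ℝ → ℝ := fun p => p.1 * dz (dθ Ψ) p.1 p.2 * dθ Ψ p.1 p.2 with hB''
  set C : ℝ × ℝ → ℝ := fun p => dθ (dθ Ψ) p.1 p.2 ^ 2 with hC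
  set D : ℝ × ℝ → ℝ := fun p => (Real.cos p.2 * χ p.1 p.2 + Real.sin p.2 * dθ χ p.1 p.2) *
    (Real.cos p.2 * χ p.1 p.2 + 2 * Real.sin p.2 * dθ χ p.1 p.2 - Real.cos p.2 * dθ (dθ χ) p.1 p.2) with hD
  set E : ℝ × ℝ → ℝ := fun p => 6 * (Ψ p.1 p.2 * dθ (dθ Ψ) p.1 p.2) with hE
  set Y : ℝ × ℝ → ℝ := fun p => dθ Ψ p.1 p.2 ^ 2 with hY
  set Z : ℝ × ℝ → ℝ := fun p => (p.1 * dz (dθ Ψ) p.1 p.2) ^ 2 with hZ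
  set X : ℝ × ℝ → ℝ := fun p => χ p.1 p.2 ^ 2 with hX
  set Xθ : ℝ × ℝ → ℝ := fun p => dθ χ p.1 p.2 ^ 2 with hXθ
  have cA : Continuous A := by simp only [hA]; fun_prop
  have cA' : Continuous A' := by simp only [hA']; fun_prop
  have cA'' : Continuous A'' := by simp only [hA'']; fun_prop
  have cB : Continuous Bf := by simp only [hBf]; fun_prop
  have cB' : Continuous B' := by simp only [hB']; fun_prop
  have cB'' : Continuous B'' := by simp only [hB'']; fun_prop
  have cC : Continuous C := by simp only [hC]; fun_prop
  have cD : Continuous D := by simp only [hD]; fun_prop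
  have cE : Continuous E := by simp only [hE]; fun_prop
  have cY : Continuous Y := by simp only [hY]; fun_prop
  have cZ : Continuous Z := by simp only [hZ]; fun_prop
  have cX : Continuous X := by simp only [hX]; fun_prop
  have cXθ : Continuous Xθ := by simp only [hXθ]; fun_prop
  -- compact supports (a compactly supported last factor)
  have sθ2 : HasCompactSupport fun p : ℝ × ℝ => dθ (dθ Ψ) p.1 p.2 := hdθ2Ψs
  have sθ : HasCompactSupport fun p : ℝ × ℝ => dθ Ψ p.1 p.2 := hdθΨs
  have sA : HasCompactSupport A := by simp only [hA]; exact sθ2.mul_left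
  have sA' : HasCompactSupport A' := by simp only [hA']; exact sθ.mul_left
  have sA'' : HasCompactSupport A'' := by simp only [hA'']; exact sθ.mul_left
  have sB : HasCompactSupport Bf := by simp only [hBf]; exact sθ2.mul_left
  have sB' : HasCompactSupport B' := by simp only [hB']; exact sθ.mul_left
  have sB'' : HasCompactSupport B'' := by simp only [hB'']; exact sθ.mul_left
  have sC : HasCompactSupport C := by
    have e : C = fun p => dθ (dθ Ψ) p.1 p.2 * dθ (dθ Ψ) p.1 p.2 := by funext p; simp only [hC]; ring
    rw [e]; exact sθ2.mul_left
  have sD : HasCompactSupport D := by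
    simp only [hD]
    refine HasCompactSupport.mul_right ?_
    exact (hs.mul_left).add ((hdθχs).mul_left)
  have sE : HasCompactSupport E := by simp only [hE]; exact (sθ2.mul_left).mul_left
  have sY : HasCompactSupport Y := by
    have e : Y = fun p => dθ Ψ p.1 p.2 * dθ Ψ p.1 p.2 := by funext p; simp only [hY]; ring
    rw [e]; exact sθ.mul_left
  have sZ : HasCompactSupport Z := by
    have e : Z = fun p : ℝ × ℝ => (p.1 * (p.1 * dz (dθ Ψ) p.1 p.2)) * dz (dθ Ψ) p.1 p.2 := by funext p; simp only [hZ]; ring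
    rw [e]; exact (hdzdθΨs).mul_left
  have sX : HasCompactSupport X := by
    have e : X = fun p => χ p.1 p.2 * χ p.1 p.2 := by funext p; simp only [hX]; ring
    rw [e]; exact hs.mul_left
  have sXθ : HasCompactSupport Xθ := by
    have e : Xθ = fun p => dθ χ p.1 p.2 * dθ χ p.1 p.2 := by funext p; simp only [hXθ]; ring
    rw [e]; exact hdθχs.mul_left
  have iA : Integrable A := cA.integrable_of_hasCompactSupport sA
  have iA' : Integrable A' := cA'.integrable_of_hasCompactSupport sA'
  have iA'' : Integrable A'' := cA''.integrable_of_hasCompactSupport sA''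
  have iB : Integrable Bf := cB.integrable_of_hasCompactSupport sB
  have iB' : Integrable B' := cB'.integrable_of_hasCompactSupport sB'
  have iB'' : Integrable B'' := cB''.integrable_of_hasCompactSupport sB''
  have iC : Integrable C := cC.integrable_of_hasCompactSupport sC
  have iD : Integrable D := cD.integrable_of_hasCompactSupport sD
  have iE : Integrable E := cE.integrable_of_hasCompactSupport sE
  have iY : Integrable Y := cY.integrable_of_hasCompactSupport sY
  have iZ : Integrable Z := cZ.integrable_of_hasCompactSupport sZ
  have iX : Integrable X := cX.integrable_of_hasCompactSupport sX
  have iXθ : Integrable Xθ := cXθ.integrable_of_hasCompactSupport sXθ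
  -- generic tools (as in the first energy identity)
  have sliceR_supp : ∀ (G : ℝ × ℝ → ℝ), HasCompactSupport G → ∀ θ : ℝ, HasCompactSupport fun R => G (R, θ) :=
    fun G hG θ => HasCompactSupport.of_support_subset_isCompact (hG.image continuous_fst) fun R hR =>
      ⟨(R, θ), subset_tsupport G hR, rfl⟩
  have vanishR : ∀ (G : ℝ × ℝ → ℝ), Integrable G → (∀ θ ∈ Ioo 0 (π / 2), ∫ R in Ioi (0 : ℝ), G (R, θ) = 0) →
      ∫ p in strip, G p = 0 := fun G hG h => by
    rw [integral_strip_eq_integral_Ioo_integral_Ioi hG]; exact setIntegral_eq_zero_of_forall_eq_zero h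
  have vanishθ : ∀ (G : ℝ × ℝ → ℝ), Integrable G → (∀ R ∈ Ioi (0 : ℝ), ∫ θ in Ioo 0 (π / 2), G (R, θ) = 0) →
      ∫ p in strip, G p = 0 := fun G hG h => by
    rw [integral_strip_eq_integral_Ioi_integral_Ioo hG]; exact setIntegral_eq_zero_of_forall_eq_zero h
  have intR : ∀ (G : ℝ × ℝ → ℝ), Continuous G → HasCompactSupport G → ∀ θ, Integrable fun R => G (R, θ) :=
    fun G hG hGs θ => (hG.comp (Continuous.prodMk_left θ)).integrable_of_hasCompactSupport (sliceR_supp G hGs θ)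
  have intθ : ∀ (G : ℝ × ℝ → ℝ), Continuous G → ∀ R, IntegrableOn (fun θ => G (R, θ)) (Ioo 0 (π / 2)) :=
    fun G hG R => ((hG.comp (Continuous.prodMk_right R)).continuousOn.integrableOn_Icc (a := 0) (b := π / 2)).mono_set
      Ioo_subset_Icc_self
  have toIoo : ∀ (g : ℝ → ℝ), ∫ θ in (0 : ℝ)..(π / 2), g θ = ∫ θ in Ioo 0 (π / 2), g θ := fun g => by
    rw [intervalIntegral.integral_of_le (by positivity), integral_Ioc_eq_integral_Ioo]
  -- slices: regularity and identification of derivatives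
  have huθ : ∀ R, ContDiff ℝ 2 fun θ => Ψ R θ := fun R => hΨ2.comp (contDiff_const.prodMk contDiff_id)
  have hχθ : ∀ R, ContDiff ℝ 2 fun θ => χ R θ := fun R => hχ2.comp (contDiff_const.prodMk contDiff_id)
  have hwzz : ∀ R, ContDiff ℝ 1 fun θ => dz (dz Ψ) R θ := fun R => hdz2Ψ.comp (contDiff_const.prodMk contDiff_id)
  have hwz : ∀ R, ContDiff ℝ 1 fun θ => dz Ψ R θ := fun R => (hdzΨ.comp (contDiff_const.prodMk contDiff_id)).of_le (by norm_num)
  have hvR : ∀ θ, ContDiff ℝ 2 fun R => dθ Ψ R θ := fun θ => hdθΨ.comp (contDiff_id.prodMk contDiff_const)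
  have hdu : ∀ R, deriv (fun θ => Ψ R θ) = fun θ => dθ Ψ R θ := fun R => rfl
  have hddu : ∀ R, deriv (deriv fun θ => Ψ R θ) = fun θ => dθ (dθ Ψ) R θ := fun R => by rw [hdu R]; rfl
  have hdwzz : ∀ R, deriv (fun θ => dz (dz Ψ) R θ) = fun θ => dθ (dz (dz Ψ)) R θ := fun R => rfl
  have hdwz : ∀ R, deriv (fun θ => dz Ψ R θ) = fun θ => dθ (dz Ψ) R θ := fun R => rfl
  have hdχ : ∀ R, deriv (fun θ => χ R θ) = fun θ => dθ χ R θ := fun R => rfl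
  have hddχ : ∀ R, deriv (deriv fun θ => χ R θ) = fun θ => dθ (dθ χ) R θ := fun R => by rw [hdχ R]; rfl
  have hdv : ∀ θ, deriv (fun R => dθ Ψ R θ) = fun R => dz (dθ Ψ) R θ := fun θ => rfl
  have hddv : ∀ θ, deriv (deriv fun R => dθ Ψ R θ) = fun R => dz (dz (dθ Ψ)) R θ := fun θ => by rw [hdv θ]; rfl
  -- mixed partials commute on the strip
  have hcomm1 : ∀ p ∈ strip, dθ (dz Ψ) p.1 p.2 = dz (dθ Ψ) p.1 p.2 := fun p hp => dθ_dz_eq_dz_dθ hΨ2.contDiffOn hp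
  have hcomm2 : ∀ p ∈ strip, dθ (dz (dz Ψ)) p.1 p.2 = dz (dz (dθ Ψ)) p.1 p.2 := by
    intro p hp
    rw [dθ_dz_eq_dz_dθ hdzΨ.contDiffOn hp]
    exact dz_congr hcomm1 hp
  -- pointwise on the strip
  have hpt : ∀ p ∈ strip, ellipticOp α Ψ p.1 p.2 * (-dθ (dθ Ψ) p.1 p.2) =
      α ^ 2 * A p + α * (5 + α) * Bf p + C p + D p + E p := by
    intro p hp
    have hcos : Real.cos p.2 ≠ 0 := (Real.cos_pos_of_mem_Ioo ⟨by linarith [hp.2.1, Real.pi_pos], hp.2.2⟩).ne'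
    have hT : Real.cos p.2 * χ p.1 p.2 / Real.cos p.2 ^ 2 +
        Real.sin p.2 * (-Real.sin p.2 * χ p.1 p.2 + Real.cos p.2 * dθ χ p.1 p.2) / Real.cos p.2 =
        Real.cos p.2 * χ p.1 p.2 + Real.sin p.2 * dθ χ p.1 p.2 := by
      rw [div_add_div _ _ (pow_ne_zero 2 hcos) hcos, div_eq_iff (mul_ne_zero (pow_ne_zero 2 hcos) hcos)]
      have := Real.sin_sq_add_cos_sq p.2
      linear_combination (-(Real.cos p.2 ^ 2 * χ p.1 p.2)) * this
    have hΨp : Ψ p.1 p.2 / Real.cos p.2 ^ 2 = Real.cos p.2 * χ p.1 p.2 / Real.cos p.2 ^ 2 := by rw [hΨ]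
    have hdθp : dθ Ψ p.1 p.2 = -Real.sin p.2 * χ p.1 p.2 + Real.cos p.2 * dθ χ p.1 p.2 := by rw [hΨ, dθ_cosProfile hχ1]
    have hdθθp : dθ (dθ Ψ) p.1 p.2 = -Real.cos p.2 * χ p.1 p.2 - 2 * Real.sin p.2 * dθ χ p.1 p.2 + Real.cos p.2 * dθ (dθ χ) p.1 p.2 := by
      rw [hΨ, dθ_dθ_cosProfile hχ2]
    have hud : DifferentiableAt ℝ (fun θ' => Ψ p.1 θ') p.2 := ((huθ p.1).differentiable (by simp)) p.2
    rw [ellipticOp_eq_expanded α hud hcos]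
    simp only [hA, hBf, hC, hD, hE]
    rw [hdθp, hΨp, hT]
    -- only the `D`-term uses the second angular derivative of `Ψ` in expanded form
    have e6 : 6 * (Ψ p.1 p.2 * dθ (dθ Ψ) p.1 p.2) = 6 * Ψ p.1 p.2 * dθ (dθ Ψ) p.1 p.2 := by ring
    rw [e6]
    have key : (Real.cos p.2 * χ p.1 p.2 + Real.sin p.2 * dθ χ p.1 p.2) * (-dθ (dθ Ψ) p.1 p.2) =
        (Real.cos p.2 * χ p.1 p.2 + Real.sin p.2 * dθ χ p.1 p.2) *
          (Real.cos p.2 * χ p.1 p.2 + 2 * Real.sin p.2 * dθ χ p.1 p.2 - Real.cos p.2 * dθ (dθ χ) p.1 p.2) := by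
      rw [hdθθp]; ring
    linear_combination key
  -- TERM A: `∫∫A = ∫∫Z − ∫∫Y`
  have hA1 : ∫ p in strip, A p = -∫ p in strip, A' p := by
    have h0 := vanishθ (fun p => A p + A' p) (iA.add iA') (fun R _ => by
      have h1 := integral_mul_deriv2_dirichlet (hwzz R) (huθ R) (hdzz0 R) (hdzz1 R)
      rw [hddu R, hdu R, hdwzz R, toIoo, toIoo] at h1
      simp only at h1
      have j1 : IntegrableOn (fun θ => R ^ 2 * dz (dz Ψ) R θ * dθ (dθ Ψ) R θ) (Ioo 0 (π / 2)) := intθ A cA R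
      have j2 : IntegrableOn (fun θ => R ^ 2 * dθ (dz (dz Ψ)) R θ * dθ Ψ R θ) (Ioo 0 (π / 2)) := intθ A' cA' R
      simp only [hA, hA']
      rw [integral_add j1 j2]
      have e1 : ∫ θ in Ioo 0 (π / 2), R ^ 2 * dz (dz Ψ) R θ * dθ (dθ Ψ) R θ = R ^ 2 * ∫ θ in Ioo 0 (π / 2), dz (dz Ψ) R θ * dθ (dθ Ψ) R θ := by
        rw [← MeasureTheory.integral_const_mul]; exact integral_congr_ae (ae_of_all _ fun θ => by ring)
      have e2 : ∫ θ in Ioo 0 (π / 2), R ^ 2 * dθ (dz (dz Ψ)) R θ * dθ Ψ R θ = R ^ 2 * ∫ θ in Ioo 0 (π / 2), dθ (dz (dz Ψ)) R θ * dθ Ψ R θ := by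
        rw [← MeasureTheory.integral_const_mul]; exact integral_congr_ae (ae_of_all _ fun θ => by ring)
      rw [e1, e2, h1]; ring)
    rw [integral_add iA.integrableOn iA'.integrableOn] at h0
    linarith
  have hA2 : ∫ p in strip, A' p = ∫ p in strip, A'' p :=
    setIntegral_congr_fun measurableSet_strip fun p hp => by simp only [hA', hA'']; rw [hcomm2 p hp]
  have hA3 : ∫ p in strip, A'' p = -(∫ p in strip, Z p) + ∫ p in strip, Y p := by
    have h0 := vanishR (fun p => A'' p + Z p - Y p) ((iA''.add iZ).sub iY) (fun θ _ => by
      have h1 := integral_Ioi_neg_sq_mul_deriv2_mul (hvR θ) hB0 (fun R hR => by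
        rcases eq_or_lt_of_le hR with h | h
        · -- at `R = B` use continuity: `dθ Ψ` vanishes for `R > B`, hence at `B`
          have hc : Continuous fun R => dθ Ψ R θ := cdθ.comp (Continuous.prodMk_left θ)
          have : (fun R => dθ Ψ R θ) =ᶠ[𝓝[>] R] fun _ => 0 := by
            refine eventually_nhdsWithin_of_forall fun R' hR' => hbdθΨ R' (h ▸ hR') θ
          have ht := (hc.continuousAt (x := R)).continuousWithinAt (s := Ioi R) |>.tendsto.congr' this
          exact tendsto_nhds_unique ht tendsto_const_nhds
        · exact hbdθΨ R h θ)
      rw [hddv θ, hdv θ] at h1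
      simp only at h1
      have j1 : IntegrableOn (fun R => R ^ 2 * dz (dz (dθ Ψ)) R θ * dθ Ψ R θ) (Ioi 0) := (intR A'' cA'' sA'' θ).integrableOn
      have j2 : IntegrableOn (fun R => (R * dz (dθ Ψ) R θ) ^ 2) (Ioi 0) := (intR Z cZ sZ θ).integrableOn
      have j3 : IntegrableOn (fun R => dθ Ψ R θ ^ 2) (Ioi 0) := (intR Y cY sY θ).integrableOn
      have j12 : IntegrableOn (fun R => R ^ 2 * dz (dz (dθ Ψ)) R θ * dθ Ψ R θ + (R * dz (dθ Ψ) R θ) ^ 2) (Ioi 0) := j1.add j2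
      simp only [hA'', hZ, hY]
      rw [integral_sub j12 j3, integral_add j1 j2]
      have e1 : ∫ R in Ioi (0 : ℝ), R ^ 2 * dz (dz (dθ Ψ)) R θ * dθ Ψ R θ = -∫ R in Ioi (0 : ℝ), -(R ^ 2 * dz (dz (dθ Ψ)) R θ) * dθ Ψ R θ := by
        rw [← MeasureTheory.integral_neg]; exact integral_congr_ae (ae_of_all _ fun R => by ring)
      rw [e1, h1]; ring)
    have k : IntegrableOn (fun p => A'' p + Z p) strip := (iA''.add iZ).integrableOn
    rw [integral_sub k iY.integrableOn, integral_add iA''.integrableOn iZ.integrableOn] at h0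
    linarith
  -- TERM B: `∫∫B = ½∫∫Y`
  have hB1 : ∫ p in strip, Bf p = -∫ p in strip, B' p := by
    have h0 := vanishθ (fun p => Bf p + B' p) (iB.add iB') (fun R _ => by
      have h1 := integral_mul_deriv2_dirichlet (hwz R) (huθ R) (hdz0 R) (hdz1 R)
      rw [hddu R, hdu R, hdwz R, toIoo, toIoo] at h1
      simp only at h1
      have j1 : IntegrableOn (fun θ => R * dz Ψ R θ * dθ (dθ Ψ) R θ) (Ioo 0 (π / 2)) := intθ Bf cB R
      have j2 : IntegrableOn (fun θ => R * dθ (dz Ψ) R θ * dθ Ψ R θ) (Ioo 0 (π / 2)) := intθ B' cB' R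
      simp only [hBf, hB']
      rw [integral_add j1 j2]
      have e1 : ∫ θ in Ioo 0 (π / 2), R * dz Ψ R θ * dθ (dθ Ψ) R θ = R * ∫ θ in Ioo 0 (π / 2), dz Ψ R θ * dθ (dθ Ψ) R θ := by
        rw [← MeasureTheory.integral_const_mul]; exact integral_congr_ae (ae_of_all _ fun θ => by ring)
      have e2 : ∫ θ in Ioo 0 (π / 2), R * dθ (dz Ψ) R θ * dθ Ψ R θ = R * ∫ θ in Ioo 0 (π / 2), dθ (dz Ψ) R θ * dθ Ψ R θ := by
        rw [← MeasureTheory.integral_const_mul]; exact integral_congr_ae (ae_of_all _ fun θ => by ring)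
      rw [e1, e2, h1]; ring)
    rw [integral_add iB.integrableOn iB'.integrableOn] at h0
    linarith
  have hB2 : ∫ p in strip, B' p = ∫ p in strip, B'' p :=
    setIntegral_congr_fun measurableSet_strip fun p hp => by simp only [hB', hB'']; rw [hcomm1 p hp]
  have hB3 : ∫ p in strip, B'' p = -((1 / 2) * ∫ p in strip, Y p) := by
    have h0 := vanishR (fun p => B'' p + (1 / 2) * Y p) (iB''.add (iY.const_mul _)) (fun θ _ => by
      have h1 := integral_Ioi_neg_mul_deriv_mul ((hvR θ).of_le (by norm_num)) hB0 (fun R hR => by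
        rcases eq_or_lt_of_le hR with h | h
        · have hc : Continuous fun R => dθ Ψ R θ := cdθ.comp (Continuous.prodMk_left θ)
          have : (fun R => dθ Ψ R θ) =ᶠ[𝓝[>] R] fun _ => 0 := by
            refine eventually_nhdsWithin_of_forall fun R' hR' => hbdθΨ R' (h ▸ hR') θ
          have ht := (hc.continuousAt (x := R)).continuousWithinAt (s := Ioi R) |>.tendsto.congr' this
          exact tendsto_nhds_unique ht tendsto_const_nhds
        · exact hbdθΨ R h θ)
      rw [hdv θ] at h1
      simp only at h1
      have j1 : IntegrableOn (fun R => R * dz (dθ Ψ) R θ * dθ Ψ R θ) (Ioi 0) := (intR B'' cB'' sB'' θ).integrableOn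
      have j3 : IntegrableOn (fun R => (1 / 2) * dθ Ψ R θ ^ 2) (Ioi 0) := ((intR Y cY sY θ).const_mul _).integrableOn
      simp only [hB'', hY]
      rw [integral_add j1 j3, MeasureTheory.integral_const_mul]
      have e1 : ∫ R in Ioi (0 : ℝ), R * dz (dθ Ψ) R θ * dθ Ψ R θ = -∫ R in Ioi (0 : ℝ), -(R * dz (dθ Ψ) R θ) * dθ Ψ R θ := by
        rw [← MeasureTheory.integral_neg]; exact integral_congr_ae (ae_of_all _ fun R => by ring)
      rw [e1, h1]; ring)
    have k : IntegrableOn (fun p => (1 / 2) * Y p) strip := (iY.const_mul _).integrableOn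
    rw [integral_add iB''.integrableOn k, MeasureTheory.integral_const_mul] at h0
    linarith
  -- TERM D: `∫∫D = 3/2∫∫Xθ + ½∫∫X`
  have hTD : ∫ p in strip, D p = (3 / 2) * (∫ p in strip, Xθ p) + (1 / 2) * ∫ p in strip, X p := by
    have h0 := vanishθ (fun p => D p - (3 / 2) * Xθ p - (1 / 2) * X p) ((iD.sub (iXθ.const_mul _)).sub (iX.const_mul _)) (fun R _ => by
      have h1 := integral_tanTerm_mul_deriv2 (hχθ R) (hχ0 R)
      rw [hddχ R, hdχ R, toIoo, toIoo, toIoo] at h1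
      have j1 : IntegrableOn (fun θ => (Real.cos θ * χ R θ + Real.sin θ * dθ χ R θ) *
          (Real.cos θ * χ R θ + 2 * Real.sin θ * dθ χ R θ - Real.cos θ * dθ (dθ χ) R θ)) (Ioo 0 (π / 2)) := intθ D cD R
      have j2 : IntegrableOn (fun θ => (3 / 2) * dθ χ R θ ^ 2) (Ioo 0 (π / 2)) := (intθ Xθ cXθ R).const_mul _
      have j3 : IntegrableOn (fun θ => (1 / 2) * χ R θ ^ 2) (Ioo 0 (π / 2)) := (intθ X cX R).const_mul _
      have j12 : IntegrableOn (fun θ => (Real.cos θ * χ R θ + Real.sin θ * dθ χ R θ) *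
          (Real.cos θ * χ R θ + 2 * Real.sin θ * dθ χ R θ - Real.cos θ * dθ (dθ χ) R θ) - (3 / 2) * dθ χ R θ ^ 2) (Ioo 0 (π / 2)) :=
        j1.sub j2
      simp only [hD, hXθ, hX]
      rw [integral_sub j12 j3, integral_sub j1 j2, MeasureTheory.integral_const_mul, MeasureTheory.integral_const_mul]
      simp only at h1
      linarith)
    have k1 : IntegrableOn (fun p => D p - (3 / 2) * Xθ p) strip := (iD.sub (iXθ.const_mul _)).integrableOn
    have k2 : IntegrableOn (fun p => (3 / 2) * Xθ p) strip := (iXθ.const_mul _).integrableOn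
    have k3 : IntegrableOn (fun p => (1 / 2) * X p) strip := (iX.const_mul _).integrableOn
    rw [integral_sub k1 k3, integral_sub iD.integrableOn k2, MeasureTheory.integral_const_mul, MeasureTheory.integral_const_mul] at h0
    linarith
  -- TERM E: `∫∫E = −6∫∫Y`
  have hTE : ∫ p in strip, E p = -6 * ∫ p in strip, Y p := by
    have h0 := vanishθ (fun p => E p + 6 * Y p) (iE.add (iY.const_mul _)) (fun R _ => by
      have h1 := integral_mul_deriv2_dirichlet ((huθ R).of_le (by norm_num)) (huθ R) (hD0 R) (hD1 R)
      rw [hddu R, hdu R, toIoo, toIoo] at h1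
      have j1 : IntegrableOn (fun θ => 6 * (Ψ R θ * dθ (dθ Ψ) R θ)) (Ioo 0 (π / 2)) := intθ E cE R
      have j2 : IntegrableOn (fun θ => 6 * dθ Ψ R θ ^ 2) (Ioo 0 (π / 2)) := (intθ Y cY R).const_mul _
      simp only [hE, hY]
      rw [integral_add j1 j2, MeasureTheory.integral_const_mul, MeasureTheory.integral_const_mul]
      have e2 : ∫ θ in Ioo 0 (π / 2), dθ Ψ R θ ^ 2 = ∫ θ in Ioo 0 (π / 2), dθ Ψ R θ * dθ Ψ R θ :=
        integral_congr_ae (ae_of_all _ fun θ => by ring)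
      rw [e2]
      simp only at h1
      linarith)
    have k : IntegrableOn (fun p => 6 * Y p) strip := (iY.const_mul _).integrableOn
    rw [integral_add iE.integrableOn k, MeasureTheory.integral_const_mul, MeasureTheory.integral_const_mul] at h0
    show ∫ p in strip, 6 * (Ψ p.1 p.2 * dθ (dθ Ψ) p.1 p.2) = _
    rw [MeasureTheory.integral_const_mul]
    simp only [hY] at h0 ⊢
    linarith
  -- assemble
  rw [setIntegral_congr_fun measurableSet_strip hpt]
  have i1 : IntegrableOn (fun p => α ^ 2 * A p) strip := (iA.const_mul _).integrableOn
  have i2 : IntegrableOn (fun p => α * (5 + α) * Bf p) strip := (iB.const_mul _).integrableOn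
  have k12 : IntegrableOn (fun p => α ^ 2 * A p + α * (5 + α) * Bf p) strip := i1.add i2
  have k123 : IntegrableOn (fun p => α ^ 2 * A p + α * (5 + α) * Bf p + C p) strip := k12.add iC.integrableOn
  have k1234 : IntegrableOn (fun p => α ^ 2 * A p + α * (5 + α) * Bf p + C p + D p) strip := k123.add iD.integrableOn
  rw [integral_add k1234 iE.integrableOn, integral_add k123 iD.integrableOn, integral_add k12 iC.integrableOn, integral_add i1 i2,
    MeasureTheory.integral_const_mul, MeasureTheory.integral_const_mul, hA1, hA2, hA3, hB1, hB2, hB3, hTD, hTE]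
  simp only [hC, hY, hZ, hX, hXθ]
  ring

end Elgindi

end Literature.Analysis.FluidPDE
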